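import Summits.ValiantsHypothesis.ValiantsHypothesis.Theorems.KPlusLogSqLawSymmetricTwoKCosts

/-!
# Route «KPlusLogSqLaw» — the symmetric `(2, K)` tropical family with `3K − 4` alternations, part 2/3: the DESIGN and the DOMINANCE of
# the three vertex types (toward crux `Lifting`, stmt-ValiantsHypothesis-19772; HOME/val-sym-lift-p4/GAP-LIFT.md §8)

HONEST FRAMING as in part 1 (`KPlusLogSqLawSymmetricTwoKCosts`): an explicit symmetric tropical design; nothing on `Lifting`, `TropicalB`,
`KPlusLogSqLaw`, `MatrixDescartes`, Door A or `VP ≠ VNP`.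

THE DESIGN (format `(2, K)`): slopes `d_l = 2^l`; valuations `v(0,0,l) = 2·ah l`, `v(1,1,l) = 2·gh l`, `v(0,1,l) = v(1,0,l) = bo l`; signs
`ε(0,0,l) = (−1)^l`, `ε(1,1,0) = −1`, `ε(1,1,l) = +1` (`l ≥ 1`), `ε(0,1,·) = ε(1,0,·) = +1`.  Terms: identity terms `idT i j` («product
points» `P_{i,j}`, weight `θ(2^i + 2^j) − 2ah i − 2gh j`, sign `(−1)^i·τ_j`) and swap terms `swT l l'` (weight `θ(2^l + 2^l') − bo l − bo l'`,
sign `−1`); every term is present, so dominance = beating every other identity term and every other swap term (`isDominant_of`).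
VERTICES: type A `P_{0,j}` at `θ = U j + 4` (`domA`), type B the interior c-point `c_l = swT l l` at `θ = U(l+1)` (`domB`), type C the second
leg `P_{i,K−1}` at `θ = U(K+i) + 4` (`domC`); each proof is the supporting-functional computation of GAP-LIFT §8: identity competitors by the
a-part + g-part decomposition (plus `2` at c-vertices), swap competitors by `2Φ(swT l₁ l₂) = ψ(l₁) + ψ(l₂)` with `ψ(l)` read from the left
(`psi_left`) or right (`psi_right`) neighbour of `c_l`, boundary classes by `big_wins`. [folklore]
-/

-- `Summit.ValiantsHypothesis.ValiantsHypothesis.…` repeats a component by the D-0017 layout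
-- (single-conjunct summit), which the `dupNamespace` linter flags; the name is mandated.
set_option linter.dupNamespace false
set_option autoImplicit false

namespace Summit.ValiantsHypothesis.ValiantsHypothesis.Theorems.LacunarySymmetroidMatrixDescartes.TropicalCensus.SymTwoK

open Summit.ValiantsHypothesis.ValiantsHypothesis.Theorems.MatrixDescartes.Negative
open Summit.ValiantsHypothesis.ValiantsHypothesis.Theorems.LacunarySymmetroidMatrixDescartes
open scoped BigOperators
open Finset

/-! ### The design -/

variable (K : ℕ)

/-- slopes `d_l = 2^l`. -/
def dd : Fin K → ℕ := fun l => 2 ^ (l : ℕ)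

/-- valuations: cell `(0,0)` ↦ `2·ah`, cell `(1,1)` ↦ `2·gh`, off-diagonal cells ↦ `bo`. -/
def vv : Fin 2 → Fin 2 → Fin K → ℤ := fun a b l =>
  if (a : ℕ) = 0 ∧ (b : ℕ) = 0 then 2 * ah K l else if (a : ℕ) = 1 ∧ (b : ℕ) = 1 then 2 * gh l else bo K l

/-- signs: `σ_l = (−1)^l` on `(0,0)`; `τ_0 = −1`, `τ_l = +1` (`l ≥ 1`) on `(1,1)`; `+1` off the diagonal. -/
def ee : Fin 2 → Fin 2 → Fin K → ℤ := fun a b l =>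
  if (a : ℕ) = 0 ∧ (b : ℕ) = 0 then (-1) ^ (l : ℕ)
  else if (a : ℕ) = 1 ∧ (b : ℕ) = 1 then (if (l : ℕ) = 0 then -1 else 1) else 1

/-- `vv_symm` (see the module docstring). [folklore] -/
theorem vv_symm (a b : Fin 2) (l : Fin K) : vv K a b l = vv K b a l := by
  unfold vv; fin_cases a <;> fin_cases b <;> simp

/-- `ee_symm` (see the module docstring). [folklore] -/
theorem ee_symm (a b : Fin 2) (l : Fin K) : ee K a b l = ee K b a l := by
  unfold ee; fin_cases a <;> fin_cases b <;> simp

/-- `ee_natAbs` (see the module docstring). [folklore] -/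
theorem ee_natAbs (a b : Fin 2) (l : Fin K) : (ee K a b l).natAbs ≤ 1 := by
  unfold ee
  split_ifs
  · rw [Int.natAbs_pow]; simp
  · simp
  · simp
  · simp

/-- `ee_ne_zero` (see the module docstring). [folklore] -/
theorem ee_ne_zero (a b : Fin 2) (l : Fin K) : ee K a b l ≠ 0 := by
  unfold ee
  split_ifs
  · exact pow_ne_zero _ (by norm_num)
  · norm_num
  · norm_num
  · norm_num

/-- the identity term with classes `(i, j)` and the swap term with classes `(l, l')`. -/
def idT (i j : Fin K) : Equiv.Perm (Fin 2) × (Fin 2 → Fin K) := (1, fun b => if (b : ℕ) = 0 then i else j)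

/-- the swap term with classes `l` (cell `(1,0)`) and `l'` (cell `(0,1)`). -/
def swT (l l' : Fin K) : Equiv.Perm (Fin 2) × (Fin 2 → Fin K) := (Equiv.swap 0 1, fun b => if (b : ℕ) = 0 then l else l')

/-- `eq_idT_of_fst` (see the module docstring). [folklore] -/
theorem eq_idT_of_fst {q : Equiv.Perm (Fin 2) × (Fin 2 → Fin K)} (h : q.1 = 1) : q = idT K (q.2 0) (q.2 1) := by
  refine Prod.ext h (funext fun b => ?_)
  unfold idT; fin_cases b <;> simp

/-- `eq_swT_of_fst` (see the module docstring). [folklore] -/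
theorem eq_swT_of_fst {q : Equiv.Perm (Fin 2) × (Fin 2 → Fin K)} (h : q.1 = Equiv.swap 0 1) :
    q = swT K (q.2 0) (q.2 1) := by
  refine Prod.ext h (funext fun b => ?_)
  unfold swT; fin_cases b <;> simp

/-- weight of an identity term. -/
theorem tropWeight_idT (θ : ℤ) (i j : Fin K) :
    tropWeight (dd K) (vv K) θ (idT K i j) = θ * (2 ^ (i : ℕ) + 2 ^ (j : ℕ)) - (2 * ah K i + 2 * gh j) := by
  unfold tropWeight idT dd vv
  simp [Fin.sum_univ_two]

/-- weight of a swap term. -/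
theorem tropWeight_swT (θ : ℤ) (l l' : Fin K) :
    tropWeight (dd K) (vv K) θ (swT K l l') = θ * (2 ^ (l : ℕ) + 2 ^ (l' : ℕ)) - (bo K l + bo K l') := by
  unfold tropWeight swT dd vv
  simp [Fin.sum_univ_two, Equiv.swap_apply_left, Equiv.swap_apply_right]

/-- sign of an identity term: `(−1)^i · τ_j`. -/
theorem termSign_idT (i j : Fin K) :
    termSign (ee K) (idT K i j) = (-1) ^ (i : ℕ) * (if (j : ℕ) = 0 then -1 else 1) := by
  unfold termSign idT ee
  simp [Fin.prod_univ_two]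

/-- sign of a swap term: `−1`. -/
theorem termSign_swT (l l' : Fin K) : termSign (ee K) (swT K l l') = -1 := by
  unfold termSign swT ee
  rw [Equiv.Perm.sign_swap (by decide : (0 : Fin 2) ≠ 1)]
  simp [Fin.prod_univ_two, Equiv.swap_apply_left, Equiv.swap_apply_right]

/-- every term of the design is present. -/
theorem termSign_ne_zero (q : Equiv.Perm (Fin 2) × (Fin 2 → Fin K)) : termSign (ee K) q ≠ 0 := by
  unfold termSign
  refine mul_ne_zero ?_ (Finset.prod_ne_zero_iff.mpr fun b _ => ee_ne_zero K _ _ _)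
  rcases Int.units_eq_one_or (Equiv.Perm.sign q.1) with h | h <;> simp [h]

/-- **dominance from the two competitor families**: it suffices to beat every other identity term and every other swap term. -/
theorem isDominant_of (θ : ℤ) (v : Equiv.Perm (Fin 2) × (Fin 2 → Fin K))
    (hid : ∀ i j : Fin K, idT K i j ≠ v → tropWeight (dd K) (vv K) θ (idT K i j) < tropWeight (dd K) (vv K) θ v)
    (hsw : ∀ l l' : Fin K, swT K l l' ≠ v → tropWeight (dd K) (vv K) θ (swT K l l') < tropWeight (dd K) (vv K) θ v) :
    IsDominant (dd K) (vv K) (ee K) θ v := by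
  refine ⟨termSign_ne_zero K v, fun q hq _ => ?_⟩
  -- a permutation of `Fin 2` is the identity or the swap (cf. `Literature.Geometry.Kaehler.Zucker.perm_fin_two`)
  have hperm : q.1 = 1 ∨ q.1 = Equiv.swap 0 1 := by
    have hinj : q.1 0 ≠ q.1 1 := fun h => absurd (q.1.injective h) (by decide)
    rcases Fin.eq_zero_or_eq_succ (q.1 0) with h0 | ⟨j, hj⟩
    · left
      have h1 : q.1 1 = 1 := by
        rcases Fin.eq_zero_or_eq_succ (q.1 1) with h1 | ⟨j', hj'⟩
        · exact absurd (h0.trans h1.symm) hinj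
        · rw [hj']; exact Fin.ext (by have := j'.isLt; simp [Fin.val_succ])
      refine Equiv.ext fun i => ?_
      fin_cases i
      · simpa using h0
      · simpa using h1
    · right
      have h0' : q.1 0 = 1 := by rw [hj]; exact Fin.ext (by have := j.isLt; simp [Fin.val_succ])
      have h1 : q.1 1 = 0 := by
        rcases Fin.eq_zero_or_eq_succ (q.1 1) with h1 | ⟨j', hj'⟩
        · exact h1
        · exfalso; apply hinj; rw [h0', hj']; exact Fin.ext (by have := j'.isLt; simp [Fin.val_succ])
      refine Equiv.ext fun i => ?_
      fin_cases i
      · simpa [Equiv.swap_apply_left] using h0'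
      · simpa [Equiv.swap_apply_right] using h1
  rcases hperm with h | h
  · have hq' := eq_idT_of_fst K h
    rw [hq']; rw [hq'] at hq; exact hid _ _ hq
  · have hq' := eq_swT_of_fst K h
    rw [hq']; rw [hq'] at hq; exact hsw _ _ hq


variable (K : ℕ)

/-! ### The three vertex types are dominant -/

/-- an interior c-point `c_l` against a supporting functional from a vertex on its LEFT (slope `θ ≤ U l + 4`), expressed through the left
neighbour `P_{0,l}`: `ψ = Φ(P_{0,l}) + (U(l+1) − θ)(2^l − 1) − 2`. [folklore] -/
theorem psi_left (l : ℕ) (θ cv xv : ℤ) :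
    2 * bq l - cv - θ * (2 * 2 ^ l - xv) =
      (2 * gh l - cv - θ * (1 + 2 ^ l - xv)) + ((2 * V * ((l : ℤ) + 1) - θ) * (2 ^ l - 1) - 2) := by
  rw [two_bq]; ring

/-- … and from a vertex on its RIGHT, through the right neighbour `P_{0,l+1}`: `ψ = Φ(P_{0,l+1}) + (θ − U(l+1) − 2)`. [folklore] -/
theorem psi_right (l : ℕ) (θ cv xv : ℤ) :
    2 * bq l - cv - θ * (2 * 2 ^ l - xv) =
      (2 * gh (l + 1) - cv - θ * (1 + 2 ^ (l + 1) - xv)) + (θ - 2 * V * ((l : ℤ) + 1) - 2) := by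
  have h := two_bq_sub_gh_succ l
  rw [pow_succ]
  linear_combination h

/-- **Type A**: the vertex `P_{0,j}` (`j ≤ K−1`) is the unique optimum at `θ = U j + 4`. -/
theorem domA (j : ℕ) (hj : j + 1 ≤ K) :
    IsDominant (dd K) (vv K) (ee K) (2 * V * j + 4) (idT K ⟨0, by omega⟩ ⟨j, by omega⟩) := by
  have hV : V = 8 := rfl
  -- the supporting functional at `P_{0,j}`: identity competitors
  have hidc : ∀ i' j' : ℕ, j' + 1 ≤ K →
      0 ≤ (2 * ah K i' - (2 * V * j + 4) * (2 ^ i' - 1)) + (2 * gh j' - 2 * gh j - (2 * V * j + 4) * (2 ^ j' - 2 ^ j)) ∧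
      ((i' ≠ 0 ∨ j' ≠ j) →
        0 < (2 * ah K i' - (2 * V * j + 4) * (2 ^ i' - 1)) + (2 * gh j' - 2 * gh j - (2 * V * j + 4) * (2 ^ j' - 2 ^ j))) := by
    intro i' j' hj'
    have hA : 0 ≤ 2 * ah K i' - (2 * V * j + 4) * (2 ^ i' - 1) :=
      apart_zero_nonneg K i' _ (by rw [hV]; push_cast; omega)
    have hG : 0 ≤ 2 * gh j' - 2 * gh j - (2 * V * j + 4) * (2 ^ j' - 2 ^ j) :=
      gpart_nonneg j j' _ (by rw [hV]; omega) (by rw [hV]; push_cast; omega)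
    refine ⟨by linarith, fun hne => ?_⟩
    rcases hne with hi | hj'ne
    · have h1 := apart_above K 0 i' (Nat.zero_le _) (2 * V * j + 4)
      rw [ah_zero, pow_zero] at h1
      have hp : (1 : ℤ) ≤ 2 ^ i' - 1 := by
        have : (2 : ℤ) ^ 1 ≤ 2 ^ i' := pow_le_pow_right₀ (by norm_num) (Nat.one_le_iff_ne_zero.mpr hi)
        linarith [this]
      have hc : (12 : ℤ) ≤ 2 * V * ((K : ℤ) + 0 + 1) - (2 * V * j + 4) := by rw [hV]; push_cast; omega
      have hprod : (12 : ℤ) * 1 ≤ (2 * V * ((K : ℤ) + 0 + 1) - (2 * V * j + 4)) * (2 ^ i' - 1) :=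
        mul_le_mul hc hp (by norm_num) (by linarith)
      push_cast at h1 hprod ⊢
      linarith
    · have := gpart_pos j j' hj'ne (2 * V * j + 4) (by rw [hV]; omega) (by rw [hV]; push_cast; omega)
      linarith
  refine isDominant_of K _ _ (fun i' j' hne => ?_) (fun l l' _ => ?_)
  · rw [tropWeight_idT, tropWeight_idT]
    have hne' : (i' : ℕ) ≠ 0 ∨ (j' : ℕ) ≠ j := by
      by_contra h; push Not at h
      apply hne
      unfold idT
      refine Prod.ext rfl (funext fun b => ?_)
      simp only
      split_ifs
      · exact Fin.ext h.1
      · exact Fin.ext h.2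
    have h := (hidc i' j' (by omega)).2 hne'
    simp only [pow_zero, ah_zero] at h ⊢
    linarith
  · rw [tropWeight_swT, tropWeight_idT]
    simp only [pow_zero, ah_zero]
    -- ψ(l) > 0 for every off-diagonal class
    have hψ : ∀ l₁ : ℕ, l₁ + 1 ≤ K →
        0 < 2 * bo K l₁ - 2 * gh j - (2 * V * j + 4) * (2 * 2 ^ l₁ - (1 + 2 ^ j)) := by
      intro l₁ hl₁
      unfold bo
      split_ifs with hint
      · rcases Nat.lt_or_ge l₁ j with hlt | hge
        · -- vertex to the right of c_{l₁}
          rw [psi_right]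
          have h0 := (hidc 0 (l₁ + 1) (by omega)).1
          rw [ah_zero, pow_zero] at h0
          have : (2 : ℤ) ≤ (2 * V * j + 4) - 2 * V * ((l₁ : ℤ) + 1) - 2 := by rw [hV]; push_cast; omega
          nlinarith
        · -- vertex to the left of (or under) c_{l₁}
          rw [psi_left]
          have h0 := (hidc 0 l₁ hl₁).1
          rw [ah_zero, pow_zero] at h0
          have hc : (12 : ℤ) ≤ 2 * V * ((l₁ : ℤ) + 1) - (2 * V * j + 4) := by rw [hV]; push_cast; omega
          have hp : (1 : ℤ) ≤ 2 ^ l₁ - 1 := by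
            have : (2 : ℤ) ^ 1 ≤ 2 ^ l₁ := pow_le_pow_right₀ (by norm_num) hint.1
            linarith
          nlinarith
      · have := big_wins K (2 * V * j + 4) (2 * gh j) (1 + 2 ^ j) l₁ hl₁ (by rw [hV]; positivity)
          (by rw [hV]; push_cast; omega) (by linarith [gh_mono (show j ≤ K by omega), ah_nonneg K K]) (by positivity)
        linarith
    have h1 := hψ l (by omega)
    have h2 := hψ l' (by omega)
    linarith

/-- **Type B**: the interior c-point `c_l` (`1 ≤ l ≤ K−2`) is the unique optimum at `θ = U(l+1)`. -/
theorem domB (l : ℕ) (hl1 : 1 ≤ l) (hl2 : l + 2 ≤ K) :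
    IsDominant (dd K) (vv K) (ee K) (2 * V * (l + 1)) (swT K ⟨l, by omega⟩ ⟨l, by omega⟩) := by
  have hV : V = 8 := rfl
  have hbo : bo K l = bq l := by unfold bo; rw [if_pos ⟨hl1, hl2⟩]
  -- identity competitors: Φ = A + G + 2
  have hidc : ∀ i' j' : ℕ,
      2 ≤ 2 * ah K i' + 2 * gh j' - 2 * bq l - (2 * V * (l + 1)) * (2 ^ i' + 2 ^ j' - 2 * 2 ^ l) := by
    intro i' j'
    have hA : 0 ≤ 2 * ah K i' - (2 * V * (l + 1)) * (2 ^ i' - 1) :=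
      apart_zero_nonneg K i' _ (by rw [hV]; push_cast; omega)
    have hG : 0 ≤ 2 * gh j' - 2 * gh l - (2 * V * (l + 1)) * (2 ^ j' - 2 ^ l) :=
      gpart_nonneg l j' _ (by rw [hV]; push_cast; omega) le_rfl
    rw [two_bq]
    nlinarith
  refine isDominant_of K _ _ (fun i' j' _ => ?_) (fun l₁ l₂ hne => ?_)
  · rw [tropWeight_idT, tropWeight_swT]
    simp only [hbo]
    have := hidc i' j'

    linarith
  · rw [tropWeight_swT, tropWeight_swT]
    simp only [hbo]
    -- ψ(l₁) ≥ 0 always, > 0 unless l₁ = l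
    have hψ : ∀ l₁ : ℕ, l₁ + 1 ≤ K →
        0 ≤ 2 * bo K l₁ - 2 * bq l - (2 * V * (l + 1)) * (2 * 2 ^ l₁ - 2 * 2 ^ l) ∧
        (l₁ ≠ l → 0 < 2 * bo K l₁ - 2 * bq l - (2 * V * (l + 1)) * (2 * 2 ^ l₁ - 2 * 2 ^ l)) := by
      intro l₁ hl₁
      by_cases heq : l₁ = l
      · subst heq
        refine ⟨?_, fun h => absurd rfl h⟩
        unfold bo; rw [if_pos ⟨hl1, hl2⟩]; linarith
      refine ⟨le_of_lt ?_, fun _ => ?_⟩ <;>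
      · unfold bo
        split_ifs with hint
        · rcases Nat.lt_or_gt_of_ne heq with hlt | hgt
          · rw [psi_right]
            have h0 := hidc 0 (l₁ + 1)
            rw [ah_zero, pow_zero] at h0
            have : (14 : ℤ) ≤ 2 * V * ((l : ℤ) + 1) - 2 * V * ((l₁ : ℤ) + 1) - 2 := by rw [hV]; push_cast; omega
            push_cast at h0 ⊢
            nlinarith
          · rw [psi_left]
            have h0 := hidc 0 l₁
            rw [ah_zero, pow_zero] at h0
            have hc : (16 : ℤ) ≤ 2 * V * ((l₁ : ℤ) + 1) - 2 * V * ((l : ℤ) + 1) := by rw [hV]; push_cast; omega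
            have hp : (1 : ℤ) ≤ 2 ^ l₁ - 1 := by
              have : (2 : ℤ) ^ 1 ≤ 2 ^ l₁ := pow_le_pow_right₀ (by norm_num) hint.1
              linarith
            push_cast at h0 ⊢
            nlinarith
        · have := big_wins K (2 * V * (l + 1)) (2 * bq l) (2 * 2 ^ l) l₁ hl₁ (by rw [hV]; positivity)
            (by rw [hV]; push_cast; omega)
            (by linarith [bq_le_gh K l (by omega), ah_nonneg K K]) (by positivity)

          linarith
    have hne' : (l₁ : ℕ) ≠ l ∨ (l₂ : ℕ) ≠ l := by
      by_contra h; push Not at h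
      apply hne
      unfold swT
      refine Prod.ext rfl (funext fun b => ?_)
      simp only
      split_ifs
      · exact Fin.ext h.1
      · exact Fin.ext h.2
    have h1 := hψ l₁ (by omega)
    have h2 := hψ l₂ (by omega)

    rcases hne' with h | h
    · have := h1.2 h; have := h2.1; linarith
    · have := h2.2 h; have := h1.1; linarith

/-- **Type C**: the second-leg vertex `P_{i,K−1}` (`1 ≤ i ≤ K−1`) is the unique optimum at `θ = U(K+i) + 4`. -/
theorem domC (i : ℕ) (hi1 : 1 ≤ i) (hi2 : i + 1 ≤ K) :
    IsDominant (dd K) (vv K) (ee K) (2 * V * (K + i) + 4) (idT K ⟨i, by omega⟩ ⟨K - 1, by omega⟩) := by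
  have hV : V = 8 := rfl
  have hK1 : ((K - 1 : ℕ) : ℤ) = (K : ℤ) - 1 := by push_cast [Nat.cast_sub (show 1 ≤ K by omega)]; ring
  -- identity competitors: Φ = A' + G'
  have hidc : ∀ i' j' : ℕ, j' + 1 ≤ K →
      0 ≤ (2 * ah K i' - 2 * ah K i - (2 * V * (K + i) + 4) * (2 ^ i' - 2 ^ i)) +
          (2 * gh j' - 2 * gh (K - 1) - (2 * V * (K + i) + 4) * (2 ^ j' - 2 ^ (K - 1))) ∧
      ((i' ≠ i ∨ j' ≠ K - 1) →
      0 < (2 * ah K i' - 2 * ah K i - (2 * V * (K + i) + 4) * (2 ^ i' - 2 ^ i)) +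
          (2 * gh j' - 2 * gh (K - 1) - (2 * V * (K + i) + 4) * (2 ^ j' - 2 ^ (K - 1)))) := by
    intro i' j' hj'
    have hA : 0 ≤ 2 * ah K i' - 2 * ah K i - (2 * V * (K + i) + 4) * (2 ^ i' - 2 ^ i) :=
      apart_nonneg K i i' _ (by omega) (by rw [hV]; push_cast; omega)
    have hG0 := gpart_below (K - 1) j' (by omega) (2 * V * (K + i) + 4)
    have hc : (0 : ℤ) < (2 * V * (K + i) + 4) - 2 * V * ((K - 1 : ℕ) : ℤ) := by rw [hK1, hV]; push_cast; nlinarith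
    have hp : (0 : ℤ) ≤ 2 ^ (K - 1) - 2 ^ j' := sub_nonneg.mpr (pow_le_pow_right₀ (by norm_num) (by omega))
    have hG : 0 ≤ 2 * gh j' - 2 * gh (K - 1) - (2 * V * (K + i) + 4) * (2 ^ j' - 2 ^ (K - 1)) := by
      nlinarith [mul_nonneg hc.le hp]
    refine ⟨by linarith, fun hne => ?_⟩
    rcases hne with hii | hjj
    · have := apart_pos K i i' hii (2 * V * (K + i) + 4) (by omega) (by rw [hV]; push_cast; omega)
      linarith
    · have hlt : j' < K - 1 := by omega
      have hp' : (0 : ℤ) < 2 ^ (K - 1) - 2 ^ j' := sub_pos.mpr (pow_lt_pow_right₀ (by norm_num) hlt)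
      nlinarith [mul_pos hc hp']
  refine isDominant_of K _ _ (fun i' j' hne => ?_) (fun l₁ l₂ _ => ?_)
  · rw [tropWeight_idT, tropWeight_idT]
    have hne' : (i' : ℕ) ≠ i ∨ (j' : ℕ) ≠ K - 1 := by
      by_contra h; push Not at h
      apply hne
      unfold idT
      refine Prod.ext rfl (funext fun b => ?_)
      simp only
      split_ifs
      · exact Fin.ext h.1
      · exact Fin.ext h.2
    have h := (hidc i' j' (by omega)).2 hne'
    

    linarith
  · rw [tropWeight_swT, tropWeight_idT]
    
    have hψ : ∀ l₁ : ℕ, l₁ + 1 ≤ K →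
        0 < 2 * bo K l₁ - (2 * ah K i + 2 * gh (K - 1)) - (2 * V * (K + i) + 4) * (2 * 2 ^ l₁ - (2 ^ i + 2 ^ (K - 1))) := by
      intro l₁ hl₁
      unfold bo
      split_ifs with hint
      · -- every interior c-point is to the left of the second leg
        rw [psi_right]
        have h0 := (hidc 0 (l₁ + 1) (by omega)).1
        rw [ah_zero, pow_zero] at h0
        have : (2 : ℤ) ≤ (2 * V * (K + i) + 4) - 2 * V * ((l₁ : ℤ) + 1) - 2 := by rw [hV]; push_cast; omega
        push_cast at h0 this ⊢
        nlinarith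
      · have := big_wins K (2 * V * (K + i) + 4) (2 * ah K i + 2 * gh (K - 1)) (2 ^ i + 2 ^ (K - 1)) l₁ hl₁
          (by rw [hV]; positivity) (by rw [hV]; push_cast; omega)
          (by linarith [gh_mono (show K - 1 ≤ K by omega), ah_mono K (show i ≤ K by omega)]) (by positivity)

        linarith
    have h1 := hψ l₁ (by omega)
    have h2 := hψ l₂ (by omega)

    linarith

end Summit.ValiantsHypothesis.ValiantsHypothesis.Theorems.LacunarySymmetroidMatrixDescartes.TropicalCensus.SymTwoK
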